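import Literature.MathematicalPhysics.QuantumLattice.FreeFermiGasNoPairFieldLRO
import Literature.MathematicalPhysics.QuantumLattice.HubbardWave0LiebProofs
import HarnessLib

/-!
# Occupation-diagonal positive weights carry no `d`-wave pair-field LRO (free Fermi gas at `β < ∞`)

Family `hubbard` / trunk T-QLATTICE. Companion of `FreeFermiGasNoPairFieldLRO.lean` (which treats
Hermitian idempotent weights, i.e. sector eigen-projections at `β = ∞`): the same basis-free
selection rule `tr (W b_k† b_{k'}) = δ_{kk'} tr (W n_{k↑} n_{-k↓})` gives, for every POSITIVE
SEMIDEFINITE weight `W` commuting with all Bloch occupation numbers `n_{kσ}` of the fermionic torus,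

  `Re tr (W Δ_d† Δ_d) ≤ 32 · L² · Re tr W`

(`re_trace_mul_conjTranspose_pairField_dWave_mul_le_of_posSemidef`; `0 ≤ tr (W Q) ≤ tr W` for a
Hermitian idempotent `Q` commuting with `W`, `re_trace_mul_mem_Icc_of_posSemidef_of_proj`). The
canonical Gibbs weight `P_S e^{-βH₀}` of the FREE torus Hamiltonian `H₀ = hubbardTorus 2 L 1 0`
(`L ≥ 3`) in any joint sector `S = szSector N M`, at ANY inverse temperature `β`, is such a weight
(`posSemidef_sectorProj_mul_gibbsWeight`, `…_commute_momentumNumber`), hence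

  `Re tr (P_S e^{-βH₀} Δ_d†Δ_d) ≤ 32 L² · Re tr (P_S e^{-βH₀})`

(`re_sectorGibbs_pairField_dWave_le_free`): the free Fermi gas has no THERMAL sector `d`-wave pair
LRO either — an `L²` law for the numerator against the full sector partition function. Context:
the thermal sockets of the lines attacking `BirGroundStateAverageLRO` (route
`HubbardSuperconductivity/BalabanIR`; e.g. the penalised thermal floor of line `Sketch` at
`κ = 0`) fail at the free point `U = 0` for every `β`, exactly like the `β = ∞` statement.

Sources: J. Bardeen, L. N. Cooper, J. R. Schrieffer, Phys. Rev. 108 (1957) 1175, §II; C. N. Yang,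
Rev. Mod. Phys. 34 (1962) 694, §3; O. Bratteli, D. W. Robinson, *Operator Algebras and QSM II*
§5.2 (gauge-invariant quasi-free states). Folklore finite-dimensional statements; no named facts,
no definitions.

## Mathlib / tree search

Tree: `trace_mul_conjTranspose_pairOperator_mul_pairOperator`, `conjTranspose_pairField_dWave_mul_self`,
`momentumNumber_commute`, `momentumNumber_mul_self`, `momentumNumber_conjTranspose`,
`momentumNumber_commute_hubbardTorus_zero`, `momentumNumber_mulVec_mem_szSector`,
`mulVec_mem_szSector_of_commute`, `projMatrix_map_commute_of_invariant`, `projMatrix_isHermitian`,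
`projMatrix_mul_self`, `Matrix.gibbsWeight`, `isHermitian_gibbsWeight`,
`hamiltonian_isHermitian_and_commute_holds`, `card_torusSite`.
Mathlib: `Matrix.PosSemidef.conjTranspose_mul_mul_same`, `Matrix.PosSemidef.trace_nonneg`,
`Commute.exp_right`, `Matrix.exp_add_of_commute`.
-/

noncomputable section

namespace Literature.MathematicalPhysics.QuantumLattice

open Matrix Finset Literature.Probability.LatticeModels
open scoped ComplexOrder ComplexConjugate

/-! ### Positive weights against commuting projections -/

section Weight

variable {n : Type*} [Fintype n] [DecidableEq n]

/-- For a positive semidefinite `W` and a Hermitian idempotent `Q` commuting with it: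
`0 ≤ Re tr (W Q) ≤ Re tr W` (`W Q = Q W Q ≥ 0` and the same with `1 - Q`). [folklore] -/
theorem re_trace_mul_mem_Icc_of_posSemidef_of_proj {W Q : Matrix n n ℂ} (hW : W.PosSemidef)
    (hQ : Qᴴ = Q) (hQQ : Q * Q = Q) (h : Commute W Q) :
    (W * Q).trace.re ∈ Set.Icc 0 W.trace.re := by
  have key : ∀ {R : Matrix n n ℂ}, Rᴴ = R → R * R = R → Commute W R → 0 ≤ (W * R).trace.re := by
    intro R hR hRR hc
    have e : W * R = Rᴴ * W * R := by
      rw [hR, Matrix.mul_assoc, hc.eq, ← Matrix.mul_assoc, hRR]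
    rw [e]
    exact (Complex.le_def.1 (hW.conjTranspose_mul_mul_same R).trace_nonneg).1
  refine ⟨key hQ hQQ h, ?_⟩
  have hB : (1 - Q)ᴴ = 1 - Q := by rw [conjTranspose_sub, conjTranspose_one, hQ]
  have hBB : (1 - Q) * (1 - Q) = 1 - Q := by
    rw [Matrix.sub_mul, Matrix.one_mul, Matrix.mul_sub, Matrix.mul_one, hQQ, sub_self, sub_zero]
  have h0 := key hB hBB ((Commute.one_right W).sub_right h)
  rw [Matrix.mul_sub, Matrix.mul_one, trace_sub, Complex.sub_re] at h0
  linarith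

end Weight

/-! ### Occupation-diagonal positive weights on the fermionic torus -/

section Torus

variable {L : ℕ} [NeZero L]

/-- **Positive occupation-diagonal weights have no `d`-wave pair LRO.** For a positive semidefinite
`W` commuting with every Bloch occupation number `n_{kσ}` of the fermionic torus of side `L`:
`Re tr (W Δ_d† Δ_d) ≤ 32 · L² · Re tr W`. Bardeen–Cooper–Schrieffer (1957) §II;
Bratteli–Robinson II §5.2. [folklore] -/
theorem re_trace_mul_conjTranspose_pairField_dWave_mul_le_of_posSemidef
    {W : Matrix (Finset (Orb (FermionTorus 2 L))) (Finset (Orb (FermionTorus 2 L))) ℂ}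
    (hW : W.PosSemidef) (hP : ∀ (k : TorusSite 2 L) (σ : Fin 2), Commute W (momentumNumber k σ)) :
    (W * ((pairField dWaveFormFactor L)ᴴ * pairField dWaveFormFactor L)).trace.re ≤
      32 * (L : ℝ) ^ 2 * W.trace.re := by
  rw [conjTranspose_pairField_dWave_mul_self, Matrix.mul_smul, trace_smul, smul_eq_mul,
    trace_mul_conjTranspose_pairOperator_mul_pairOperator dWaveGap (fun k _ => hP k 0),
    Complex.re_ofReal_mul, Complex.re_sum]
  have hterm : ∀ k : TorusSite 2 L,
      ((dWaveGap k : ℂ) ^ 2 * (W * (momentumNumber k 0 * momentumNumber (-k) 1)).trace).re ≤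
        4 * W.trace.re := by
    intro k
    rw [← Complex.ofReal_pow, Complex.re_ofReal_mul]
    have hA : (momentumNumber k 0 * momentumNumber (-k) 1)ᴴ = momentumNumber k 0 * momentumNumber (-k) 1 := by
      rw [conjTranspose_mul, momentumNumber_conjTranspose, momentumNumber_conjTranspose]
      exact (momentumNumber_commute _ _ _ _).eq
    have hAA : momentumNumber k 0 * momentumNumber (-k) 1 * (momentumNumber k 0 * momentumNumber (-k) 1) =
        momentumNumber k 0 * momentumNumber (-k) 1 := by
      rw [Matrix.mul_assoc, ← Matrix.mul_assoc (momentumNumber (-k) 1) (momentumNumber k 0),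
        (momentumNumber_commute (-k) k 1 0).eq, Matrix.mul_assoc, momentumNumber_mul_self,
        ← Matrix.mul_assoc, momentumNumber_mul_self]
    obtain ⟨h0, h1⟩ := re_trace_mul_mem_Icc_of_posSemidef_of_proj hW hA hAA
      ((hP k 0).mul_right (hP (-k) 1))
    have hg : dWaveGap k ^ 2 ≤ 4 := by
      unfold dWaveGap
      have ha := Real.abs_cos_le_one (latticeMomentum L k 0)
      have hb := Real.abs_cos_le_one (latticeMomentum L k 1)
      rw [abs_le] at ha hb
      nlinarith
    have hg0 : 0 ≤ dWaveGap k ^ 2 := sq_nonneg _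
    nlinarith
  have hsum : ∑ k : TorusSite 2 L,
      ((dWaveGap k : ℂ) ^ 2 * (W * (momentumNumber k 0 * momentumNumber (-k) 1)).trace).re ≤
        (L : ℝ) ^ 2 * (4 * W.trace.re) := by
    calc _ ≤ ∑ _k : TorusSite 2 L, 4 * W.trace.re := Finset.sum_le_sum fun k _ => hterm k
      _ = (L : ℝ) ^ 2 * (4 * W.trace.re) := by
          rw [Finset.sum_const, Finset.card_univ, card_torusSite, nsmul_eq_mul]
          push_cast
          ring
  nlinarith

/-- At `U = 0` (`L ≥ 3`) the Gibbs weight `e^{-βH₀}` of the free torus Hamiltonian commutes with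
every `n_{kσ}`. [folklore] -/
theorem gibbsWeight_hubbardTorus_zero_commute_momentumNumber (hL : 3 ≤ L) (β : ℝ)
    (k : TorusSite 2 L) (σ : Fin 2) :
    Commute (gibbsWeight β (hubbardTorus 2 L 1 0)) (momentumNumber k σ) := by
  unfold gibbsWeight
  exact (((momentumNumber_commute_hubbardTorus_zero hL k σ).smul_right _).symm.exp_left)

omit [NeZero L] in
/-- The torus Hubbard Hamiltonian maps every joint sector `szSector N M` into itself. [folklore] -/
theorem hubbardTorus_mulVec_mem_szSector (t U : ℝ) {N : ℕ} {M : ℝ}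
    {v : Fock (Orb (FermionTorus 2 L))} (hv : v ∈ szSector (Λ := FermionTorus 2 L) N M) :
    hubbardTorus 2 L t U *ᵥ v ∈ szSector (Λ := FermionTorus 2 L) N M := by
  obtain ⟨-, hN, hS⟩ := hamiltonian_isHermitian_and_commute_holds (fermionTorusGraph 2 L) t U
  exact mulVec_mem_szSector_of_commute hN hS hv

/-- The orthogonal projection onto a joint sector commutes with the torus Hubbard Hamiltonian and
with every `n_{kσ}`. [folklore] -/
theorem projMatrix_szSector_commute (t U : ℝ) (N : ℕ) (M : ℝ) :
    Commute (projMatrix ((szSector (Λ := FermionTorus 2 L) N M).map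
        ((WithLp.linearEquiv 2 ℂ (Finset (Orb (FermionTorus 2 L)) → ℂ)).symm :
          (Finset (Orb (FermionTorus 2 L)) → ℂ) →ₗ[ℂ] EuclideanSpace ℂ (Finset (Orb (FermionTorus 2 L))))))
      (hubbardTorus 2 L t U) ∧
    ∀ (k : TorusSite 2 L) (σ : Fin 2),
      Commute (projMatrix ((szSector (Λ := FermionTorus 2 L) N M).map
        ((WithLp.linearEquiv 2 ℂ (Finset (Orb (FermionTorus 2 L)) → ℂ)).symm :
          (Finset (Orb (FermionTorus 2 L)) → ℂ) →ₗ[ℂ] EuclideanSpace ℂ (Finset (Orb (FermionTorus 2 L))))))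
        (momentumNumber k σ) := by
  refine ⟨projMatrix_map_commute_of_invariant (LiebThm1.hamiltonian_isHermitian _ t U) _
      fun v hv => hubbardTorus_mulVec_mem_szSector t U hv, fun k σ => ?_⟩
  exact projMatrix_map_commute_of_invariant (momentumNumber_conjTranspose k σ) _
    fun v hv => momentumNumber_mulVec_mem_szSector k σ hv

/-- **The free canonical Gibbs weight is positive**: `P_S e^{-βH₀} = e^{-βH₀/2} P_S e^{-βH₀/2} ≥ 0`
for the sector projection `P_S` (which commutes with `H₀`; any `t, U` in fact). [folklore] -/
theorem posSemidef_sectorProj_mul_gibbsWeight (t U : ℝ) (N : ℕ) (M : ℝ) (β : ℝ) :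
    (projMatrix ((szSector (Λ := FermionTorus 2 L) N M).map
        ((WithLp.linearEquiv 2 ℂ (Finset (Orb (FermionTorus 2 L)) → ℂ)).symm :
          (Finset (Orb (FermionTorus 2 L)) → ℂ) →ₗ[ℂ] EuclideanSpace ℂ (Finset (Orb (FermionTorus 2 L))))) *
      gibbsWeight β (hubbardTorus 2 L t U)).PosSemidef := by
  set P := projMatrix ((szSector (Λ := FermionTorus 2 L) N M).map
        ((WithLp.linearEquiv 2 ℂ (Finset (Orb (FermionTorus 2 L)) → ℂ)).symm :
          (Finset (Orb (FermionTorus 2 L)) → ℂ) →ₗ[ℂ] EuclideanSpace ℂ (Finset (Orb (FermionTorus 2 L)))))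
    with hPdef
  have hH : (hubbardTorus 2 L t U).IsHermitian := LiebThm1.hamiltonian_isHermitian _ t U
  have hPH : Commute P (hubbardTorus 2 L t U) := (projMatrix_szSector_commute t U N M).1
  have hPh : Pᴴ = P := (projMatrix_isHermitian _).eq
  have hPP : P * P = P := projMatrix_mul_self _
  -- `P` is positive (Hermitian idempotent) and commutes with `X = e^{-(β/2)H}`
  have hPpos : P.PosSemidef := by
    have : P = Pᴴ * P := by rw [hPh, hPP]
    rw [this]
    exact posSemidef_conjTranspose_mul_self P
  have hX : (gibbsWeight (β / 2) (hubbardTorus 2 L t U))ᴴ = gibbsWeight (β / 2) (hubbardTorus 2 L t U) :=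
    (isHermitian_gibbsWeight (β / 2) hH).eq
  have hPX : Commute P (gibbsWeight (β / 2) (hubbardTorus 2 L t U)) := by
    unfold gibbsWeight
    exact (hPH.smul_right _).exp_right
  have hsplit : gibbsWeight β (hubbardTorus 2 L t U) =
      gibbsWeight (β / 2) (hubbardTorus 2 L t U) * gibbsWeight (β / 2) (hubbardTorus 2 L t U) := by
    rw [gibbsWeight, gibbsWeight, ← Matrix.exp_add_of_commute]
    · congr 1
      push_cast
      module
    · exact ((Commute.refl _).smul_left _).smul_right _
  have e : P * gibbsWeight β (hubbardTorus 2 L t U) =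
      (gibbsWeight (β / 2) (hubbardTorus 2 L t U))ᴴ * P * gibbsWeight (β / 2) (hubbardTorus 2 L t U) := by
    rw [hsplit, ← Matrix.mul_assoc, hPX.eq, hX]
  rw [e]
  exact hPpos.conjTranspose_mul_mul_same _

/-- **The free Fermi gas has no thermal sector `d`-wave pair LRO.** For the free torus Hamiltonian
`H₀ = hubbardTorus 2 L 1 0`, `L ≥ 3`, any joint sector `S = szSector N M` with projection `P_S`,
and ANY inverse temperature `β`:
`Re tr (P_S e^{-βH₀} Δ_d†Δ_d) ≤ 32 · L² · Re tr (P_S e^{-βH₀})`. Bardeen–Cooper–Schrieffer (1957)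
§II; Bratteli–Robinson II §5.2. [folklore] -/
theorem re_sectorGibbs_pairField_dWave_le_free (hL : 3 ≤ L) (N : ℕ) (M : ℝ) (β : ℝ) :
    let P := projMatrix ((szSector (Λ := FermionTorus 2 L) N M).map
        ((WithLp.linearEquiv 2 ℂ (Finset (Orb (FermionTorus 2 L)) → ℂ)).symm :
          (Finset (Orb (FermionTorus 2 L)) → ℂ) →ₗ[ℂ] EuclideanSpace ℂ (Finset (Orb (FermionTorus 2 L)))))
    (P * gibbsWeight β (hubbardTorus 2 L 1 0) *
        ((pairField dWaveFormFactor L)ᴴ * pairField dWaveFormFactor L)).trace.re ≤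
      32 * (L : ℝ) ^ 2 * (P * gibbsWeight β (hubbardTorus 2 L 1 0)).trace.re := by
  intro P
  exact re_trace_mul_conjTranspose_pairField_dWave_mul_le_of_posSemidef
    (posSemidef_sectorProj_mul_gibbsWeight 1 0 N M β)
    fun k σ => ((projMatrix_szSector_commute 1 0 N M).2 k σ).mul_left
      (gibbsWeight_hubbardTorus_zero_commute_momentumNumber hL β k σ)

end Torus

end Literature.MathematicalPhysics.QuantumLattice
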